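/-
Copyright (c) 2026. All rights reserved.
Released under Apache 2.0 license as described in the file LICENSE.
Authors: abc-iut cell, fact-proving seat abc-iut-f-102 (block F, tranche 102).
-/
import Literature.AnabelianGeometry.AbsoluteAnabelian.LogFrobeniusCoresProofs
import Literature.AnabelianGeometry.AbsoluteAnabelian.LogFrobeniusRigidityProofs
import Literature.AnabelianGeometry.AbsoluteAnabelian.LogFrobeniusSettingNonVacuity
import HarnessLib

/-!
# [AbsTopIII] Corollary 5.5 (v), third clause, and (i)/(iii) realised in one family: NECESSARY CONDITIONS and the universal closures of FACT-LIST rows F-0156 / F-0157 / F-0159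

S. Mochizuki, *Topics in absolute anabelian geometry III: global reconstruction algorithms*,
J. Math. Sci. Univ. Tokyo 22 (2015) 939–1156 [MochizukiAbsTopIII2015]; locators `p.N` = pages of the
author's manuscript (`paper:url-5493eb38cbb7`): Def 3.5 (ii), (iii) pp. 75–76, Cor 5.5 (i) p. 130, (iii) p. 131,
(v) pp. 131–132 (proof p. 133).

PROOF-ONLY companion (no `def`, nothing restated) of `LogFrobeniusRigidity.lean` (abc-iut-L4-t3: the `Prop`s
`LogFrobeniusSetting.Cor55ShiftAction` = F-0157, `Cor55Rigidity` = F-0156, `RealisesCor55Families` = F-0159) and of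
abc-iut-w5-d112's `LogFrobeniusRigidityProofs.lean` (`cor55ShiftAction_iff`: clauses (1)–(2) of `Cor55ShiftAction`
hold for every setting, so `Cor55ShiftAction L` is its clause (3): ONE family of homotopies `K` on `D•⊢` realising the
cores of Cor 5.5 (i) and the observables `S_log⊞_v` of Cor 5.5 (iii) — `RealisesCor55Families K` — with which every
shift `⋎ ↦ ⋎ + k` is compatible).  All three rows are PARAMETRISED over the interface `L : LogFrobeniusSetting Vmod isArc`
(and `K`); this file records, for EVERY setting, what clause (3) entails, and settles the kernel status of the three
universal closures (R5: a universal closure of a schema row is not a fact):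

* `cor55Cores_of_realisesCor55Families`, `cor55Observables_of_realisesCor55Families`: a realising family carries
  the three cores of Cor 5.5 (i) (`Cor55Cores`, F-0139-style row, proved by abc-iut-L4-t15 for `V(F_mod) ≠ ∅`) and
  the observables of Cor 5.5 (iii) (`Cor55Observables`); hence `nonempty_of_realisesCor55Families`: `V(F_mod) ≠ ∅`
  (abc-iut-L4-t15's `cor55Cores_iff_nonempty`: with `V(F_mod) = ∅` the vertex `□` cannot reach `ℰ•`);
* the same for `Cor55ShiftAction` (`cor55Cores_of_cor55ShiftAction`, `cor55Observables_of_cor55ShiftAction`,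
  `nonempty_of_cor55ShiftAction`) and `not_cor55ShiftAction_of_isEmpty`, `not_cor55Rigidity_of_isEmpty`,
  `not_realisesCor55Families_of_isEmpty`; `cor55Rigidity_iff` (F-0156 = id-rigidity of `𝒳` ∧ clause (3));
* `not_realisesCor55Families_of_forall_not`: NO setting realises its cores inside a family with EMPTY boundary set
  (a core has the pair `([γ],[γ])` for the path `□ → 𝒩⊞_v → 𝒩_v → ℰ•`, or no path at all), so
  `exists_not_realisesCor55Families : ∃ K, ¬ L.RealisesCor55Families K` for EVERY `L` — the universal closure
  `∀ L K, RealisesCor55Families K` of F-0159 is REFUTED outright (`not_forall_realisesCor55Families`);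
* `not_forall_cor55ShiftAction`, `not_forall_cor55Rigidity`: the universal closures of F-0157 / F-0156 are REFUTED
  (at any setting over the empty index set, which exists by abc-iut-w4-d095's `LogFrobeniusSetting.nonempty`; for
  F-0156 see also w4-d095's `exists_not_cor55Rigidity` via the first conjunct).

The POSITIVE instance forms (clause (3) HOLDS at the diagonal setting for `V(F_mod) ≠ ∅`) and the sharper necessary
condition "inside one family, a core compatible with `S_log⊞_v` forces every pre-log `ι⊞_{v,ε}` to become invertible
over `ℰ•`" are the sequel file `LogFrobeniusShiftActionDiagonal.lean`.  HONEST LABEL: necessary conditions on, and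
degenerate corners of, TYPED statements; nothing about print's genuine `Th•_T[Z]` is impugned (there `V(F_mod) ≠ ∅`).
Refereed pre-IUT anabelian geometry; nothing here bears on [IUTchIII] Cor. 3.12; typed ≠ proved.
-/

set_option autoImplicit false

universe u

open CategoryTheory Quiver

namespace Literature.AnabelianGeometry.AbsoluteAnabelian

namespace LogFrobeniusSetting

variable {Vmod : Type u} {isArc : Vmod → Bool} (L : LogFrobeniusSetting Vmod isArc)

/-! ## What a realising family carries (Cor 5.5 (i), (iii)) -/

/-- A core structure embedded in a family `K` on `D•⊢` (`IsCoreOnIn`) is in particular a core structure (Cor 5.5 (i),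
`IsCoreOn`). [cite: MochizukiAbsTopIII2015, Cor 5.5 (i) p. 130] -/
theorem isCoreOn_of_isCoreOnIn {K : L.diagram.HomotopyFamily} {P : DVertex Vmod isArc → Prop}
    {x : DVertex Vmod isArc} (h : L.IsCoreOnIn K P x) : L.IsCoreOn P x := by
  obtain ⟨H, hH, hcore, -⟩ := h
  exact ⟨H, hH, hcore⟩

/-- A family realising Cor 5.5 (i)/(iii) carries the three cores of Cor 5.5 (i) (`Cor55Cores`).
[cite: MochizukiAbsTopIII2015, Cor 5.5 (i) p. 130] -/
theorem cor55Cores_of_realisesCor55Families {K : L.diagram.HomotopyFamily} (h : L.RealisesCor55Families K) :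
    L.Cor55Cores :=
  ⟨L.isCoreOn_of_isCoreOnIn h.1, L.isCoreOn_of_isCoreOnIn h.2.1, L.isCoreOn_of_isCoreOnIn h.2.2.1⟩

/-- A family realising Cor 5.5 (i)/(iii) carries the observables `S_log⊞_v` of Cor 5.5 (iii) (`Cor55Observables`).
[cite: MochizukiAbsTopIII2015, Cor 5.5 (iii) p. 131] -/
theorem cor55Observables_of_realisesCor55Families {K : L.diagram.HomotopyFamily} (h : L.RealisesCor55Families K) :
    L.Cor55Observables := fun v => by
  obtain ⟨H, hH, -⟩ := h.2.2.2 v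
  exact ⟨H, hH⟩

/-- A realising family exists only if `V(F_mod) ≠ ∅` (the core of Cor 5.5 (i), `n = 5`, needs an arrow out of `□`).
[cite: MochizukiAbsTopIII2015, Cor 5.5 (i) p. 130] -/
theorem nonempty_of_realisesCor55Families {K : L.diagram.HomotopyFamily} (h : L.RealisesCor55Families K) :
    Nonempty Vmod :=
  L.cor55Cores_iff_nonempty.mp (L.cor55Cores_of_realisesCor55Families h)

/-- With `V(F_mod) = ∅` no family of homotopies on `D•⊢` realises the cores of Cor 5.5 (i) (degenerate corner of the
typed F-0159). [cite: MochizukiAbsTopIII2015, Cor 5.5 (i) p. 130] -/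
theorem not_realisesCor55Families_of_isEmpty [IsEmpty Vmod] (K : L.diagram.HomotopyFamily) :
    ¬ L.RealisesCor55Families K :=
  fun h => L.not_cor55Cores_of_isEmpty (L.cor55Cores_of_realisesCor55Families h)

/-! ## What the `ℤ`-action clause of Cor 5.5 (v) carries -/

/-- `Cor55ShiftAction L` carries the three cores of Cor 5.5 (i). [cite: MochizukiAbsTopIII2015, Cor 5.5 (v) p. 132] -/
theorem cor55Cores_of_cor55ShiftAction (h : L.Cor55ShiftAction) : L.Cor55Cores := by
  obtain ⟨K, hK, -⟩ := L.cor55ShiftAction_iff.mp h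
  exact L.cor55Cores_of_realisesCor55Families hK

/-- `Cor55ShiftAction L` carries the observables of Cor 5.5 (iii). [cite: MochizukiAbsTopIII2015, Cor 5.5 (v) p. 132] -/
theorem cor55Observables_of_cor55ShiftAction (h : L.Cor55ShiftAction) : L.Cor55Observables := by
  obtain ⟨K, hK, -⟩ := L.cor55ShiftAction_iff.mp h
  exact L.cor55Observables_of_realisesCor55Families hK

/-- `Cor55ShiftAction L` holds only if `V(F_mod) ≠ ∅`. [cite: MochizukiAbsTopIII2015, Cor 5.5 (v) p. 132] -/
theorem nonempty_of_cor55ShiftAction (h : L.Cor55ShiftAction) : Nonempty Vmod :=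
  L.cor55Cores_iff_nonempty.mp (L.cor55Cores_of_cor55ShiftAction h)

/-- **`V(F_mod) ≠ ∅` is necessary for the typed Cor 5.5 (v), third clause** (F-0157): over the empty index set the
compatibility clause (3) fails because no core of `D•_{≤5}` on `D•_{≤4}` exists (abc-iut-L4-t15,
`not_cor55Cores_of_isEmpty`). A number field never presents this corner. [cite: MochizukiAbsTopIII2015, Cor 5.5 (v) p. 132] -/
theorem not_cor55ShiftAction_of_isEmpty [IsEmpty Vmod] : ¬ L.Cor55ShiftAction :=
  fun h => (L.nonempty_of_cor55ShiftAction h).elim fun v => IsEmpty.false v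

/-- Hence also Cor 5.5 (v) as one node (F-0156) fails over the empty index set. [cite: MochizukiAbsTopIII2015, Cor 5.5 (v) p. 131] -/
theorem not_cor55Rigidity_of_isEmpty [IsEmpty Vmod] : ¬ L.Cor55Rigidity :=
  fun h => L.not_cor55ShiftAction_of_isEmpty h.2

/-- **Cor 5.5 (v) as one node, REDUCED** (F-0156): total `□`-rigidity ∧ the `ℤ`-action clause holds iff `𝒳 = Th•_T[Z]` is
id-rigid (abc-iut-w5-d112, `cor55CoreRigid_iff`) and ONE family of homotopies on `D•⊢` realises the cores of (i) and the
observables of (iii) compatibly with every shift (`cor55ShiftAction_iff`). [cite: MochizukiAbsTopIII2015, Cor 5.5 (v) pp. 131–133] -/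
theorem cor55Rigidity_iff : L.Cor55Rigidity ↔ IsIdRigid L.X ∧
    ∃ K : L.diagram.HomotopyFamily, L.RealisesCor55Families K ∧
      ∀ k : ℤ, Nonempty ((L.shiftOneMorphism k).CompatibleWith K K) :=
  and_congr L.cor55CoreRigid_iff L.cor55ShiftAction_iff

/-! ## The universal closure of F-0159 is refuted at EVERY setting: the family with empty boundary set -/

/-- A family of homotopies on `D•⊢` whose boundary set is EMPTY realises no core: the core of Cor 5.5 (i), `n = 5`, has the
boundary pair `([γ],[γ])` for a path `γ` from `□` to `ℰ•` (Def 3.5 (iii): all co-verticial pairs into the core vertex, and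
every vertex reaches it), whose image must be a boundary pair of `K` (Def 3.5 (ii), compatible families).
[cite: MochizukiAbsTopIII2015, Definition 3.5 (iii) pp. 75–76] -/
theorem not_realisesCor55Families_of_forall_not (K : L.diagram.HomotopyFamily)
    (hK : ∀ ⦃a b : DVertex Vmod isArc⦄ (p q : Path a b), ¬ K.E p q) : ¬ L.RealisesCor55Families K := by
  rintro ⟨⟨H, hH, hcore, hcompat⟩, -⟩
  have hc : DVertex.InFirstRows (Vmod := Vmod) (isArc := isArc) 4 .core := ⟨trivial, by simp [DVertex.row]⟩
  obtain ⟨p⟩ := hcore.reaches_obs ⟨.core, hc⟩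
  obtain ⟨h', -⟩ := hcompat p p (hcore.boundary_all p p)
  exact hK _ _ h'

/-- **For EVERY setting `L` some family of homotopies on `D•⊢` does NOT realise Cor 5.5 (i)/(iii)** — the family with empty
boundary set (vacuously a family, Def 3.5 (ii)). So `RealisesCor55Families` (F-0159) is a condition selecting `K`, never a
property of all `K`. [cite: MochizukiAbsTopIII2015, Cor 5.5 (iii) p. 131] -/
theorem exists_not_realisesCor55Families : ∃ K : L.diagram.HomotopyFamily, ¬ L.RealisesCor55Families K :=
  ⟨{ E := fun _ _ _ _ => False
     isSaturated :=
       { refl_left := fun _ _ _ _ h => h.elim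
         refl_right := fun _ _ _ _ h => h.elim
         trans := fun _ _ _ _ _ h _ => h.elim
         precomp := fun _ _ _ _ _ h _ => h.elim
         postcomp := fun _ _ _ _ _ h _ => h.elim }
     η := fun _ _ _ _ h => h.elim
     η_refl := fun _ _ _ h => h.elim
     η_trans := fun _ _ _ _ _ h _ => h.elim
     η_whisker := fun _ _ _ _ _ _ h _ _ => h.elim },
    L.not_realisesCor55Families_of_forall_not _ (fun _ _ _ _ h => h)⟩

end LogFrobeniusSetting

/-! ## The universal closures of F-0159, F-0157, F-0156 -/

/-- **The universal closure of F-0159 (`RealisesCor55Families`, over all settings AND all families) is REFUTED** — already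
by the empty-boundary family at any one setting (settings exist over every index set: abc-iut-w4-d095's
`LogFrobeniusSetting.nonempty`). R5: the row is consumable at NAMED instances only.
[cite: MochizukiAbsTopIII2015, Cor 5.5 (iii) p. 131] -/
theorem LogFrobeniusSetting.not_forall_realisesCor55Families :
    ¬ ∀ (Vmod : Type u) (isArc : Vmod → Bool) (L : LogFrobeniusSetting Vmod isArc) (K : L.diagram.HomotopyFamily),
      L.RealisesCor55Families K := by
  intro h
  obtain ⟨L⟩ := LogFrobeniusSetting.nonempty PEmpty.{u + 1} (fun _ => false)
  obtain ⟨K, hK⟩ := L.exists_not_realisesCor55Families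
  exact hK (h _ _ L K)

/-- **The universal closure of F-0157 (`Cor55ShiftAction`, over all settings) is REFUTED**: it fails at every setting over
the EMPTY index set (`not_cor55ShiftAction_of_isEmpty`), and such settings exist (`LogFrobeniusSetting.nonempty`). R5: the
row is an assumption on the genuine setting (where `V(F_mod) ≠ ∅`), consumable at named instances only.
[cite: MochizukiAbsTopIII2015, Cor 5.5 (v) p. 132] -/
theorem LogFrobeniusSetting.not_forall_cor55ShiftAction :
    ¬ ∀ (Vmod : Type u) (isArc : Vmod → Bool) (L : LogFrobeniusSetting Vmod isArc), L.Cor55ShiftAction := by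
  intro h
  obtain ⟨L⟩ := LogFrobeniusSetting.nonempty PEmpty.{u + 1} (fun _ => false)
  exact L.not_cor55ShiftAction_of_isEmpty (h _ _ L)

/-- **The universal closure of F-0156 (`Cor55Rigidity`, over all settings) is REFUTED** (second conjunct over the empty
index set; for the first conjunct see abc-iut-w4-d095's `exists_not_cor55Rigidity`). [cite: MochizukiAbsTopIII2015, Cor 5.5 (v) p. 131] -/
theorem LogFrobeniusSetting.not_forall_cor55Rigidity :
    ¬ ∀ (Vmod : Type u) (isArc : Vmod → Bool) (L : LogFrobeniusSetting Vmod isArc), L.Cor55Rigidity := by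
  intro h
  obtain ⟨L⟩ := LogFrobeniusSetting.nonempty PEmpty.{u + 1} (fun _ => false)
  exact L.not_cor55Rigidity_of_isEmpty (h _ _ L)

end Literature.AnabelianGeometry.AbsoluteAnabelian
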